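import Literature.Geometry.Lorentzian.KerrIngoingCoordPullback
import Literature.Geometry.Lorentzian.KerrIngoingCoordRicciFlat
import Literature.Geometry.Lorentzian.ImmersedChartRicci
import Literature.Geometry.Lorentzian.CurvatureRegularity
import Literature.Geometry.Lorentzian.ChartConnection
import Literature.Geometry.Lorentzian.KerrData
import Literature.Geometry.Lorentzian.Einstein
import HarnessLib

/-!
# The Kerr metric is Ricci-flat (all spins): discharge of the named fact `Kerr.isRicciFlat`

**Theorem** (`Kerr.isRicciFlat_holds`). For all real `M, a, r₀`, the Kerr metric
`g_{M,a} = η + 2H ℓ ⊗ ℓ` in ingoing Kerr–Schild Cartesian coordinates (`Kerr.metric M a r₀`,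
`KerrSchild.lean`) is Ricci-flat on the whole chart domain `Kerr.region a r₀ = {r > max r₀ 0}`:
`Ric = 0`. Kerr, PRL 11 (1963); Kerr–Schild 1965, §3; O'Neill 1995, Ch. 2, Thm. 2.6.1. This
discharges the named fact `Kerr.isRicciFlat` of the prelude for every spin (the case `a = 0`,
Schwarzschild, was `Kerr.isRicciFlat_zero_spin`, `SchwarzschildKerrSchildRicciFlat.lean`).

## Proof

Off the rotation axis `{x = y = 0}` the chart domain is covered by the ingoing Kerr coordinates
`(t*, r, μ, φ)` (`KerrIngoingCoordChart.lean`, `KerrIngoingCoordPullback.lean`: the map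
`Ψ = Kerr.Ingoing.chart` is smooth on the coordinate domain `A`, with injective Jacobian, and pulls
the Kerr–Schild form back to the rational component field `Kerr.Ingoing.bilin`,
`Kerr.Ingoing.kerrBilin_jac`). The pull-back metric `Ψ^* g` on
`A` (`PseudoRiemannianMetric.comap`) therefore has the Kerr components, so its Ricci tensor
vanishes (`Kerr.Ingoing.ricci_eq_zero_of_repr`, `KerrIngoingCoordRicci.lean` /
`KerrIngoingCoordRicciFlat.lean`: sixteen rational identities), and by naturality of the Ricci tensor under the local isometry `(A, Ψ^*g) → (region, g)`
(`PseudoRiemannianMetric.ricci_comap_apply`, O'Neill 1983, Ch. 3, Prop. 3.59) `Ric^g` vanishes at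
every off-axis point on all pairs `(dΨ v, dΨ w)`, which span. On the axis, `Ric^g_x(V, W)` is a
continuous function of `x` (`PseudoRiemannianMetric.contMDiff_ricci_apply'`) vanishing on the dense
off-axis part of the open chart domain, hence everywhere (`Kerr.eqOn_region_of_offAxis`).

## References

* R. P. Kerr, *Gravitational field of a spinning mass as an example of algebraically special
  metrics*, Phys. Rev. Lett. 11 (1963) 237–238.
* R. P. Kerr, A. Schild, *A new class of vacuum solutions of the Einstein field equations* (1965), §3.
* B. O'Neill, *The geometry of Kerr black holes* (1995), Ch. 2, Thm. 2.6.1; *Semi-Riemannian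
  geometry* (1983), Ch. 3, Prop. 3.59.
-/

noncomputable section

set_option maxSynthPendingDepth 3

open Bundle TopologicalSpace Manifold Set Module Filter Function
open scoped ContDiff Topology

namespace Literature.Geometry.Lorentzian

namespace Kerr

/-! ### Passing to the axis by continuity, on the four-dimensional chart domain -/

/-- **Off-axis points are dense in the chart domain, in the form used for identities**: a function
continuous on `Kerr.region a r₀` taking the value `c` at every point with `(x, y) ≠ (0, 0)` takes the
value `c` everywhere on the region (approach an axis point `x` by `x + t ∂₁`, `t → 0`, inside the
open region; the four-dimensional analogue of `Kerr.eqOn_slice_of_offAxis`). [folklore] -/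
theorem eqOn_region_of_offAxis {X : Type*} [TopologicalSpace X] [T2Space X] {a r₀ : ℝ}
    {G : E4 → X} {c : X} (hG : ContinuousOn G (region a r₀))
    (h : ∀ y ∈ region a r₀, (y 1 ≠ 0 ∨ y 2 ≠ 0) → G y = c) :
    ∀ y ∈ region a r₀, G y = c := by
  intro y hy
  by_cases hax : y 1 ≠ 0 ∨ y 2 ≠ 0
  · exact h y hy hax
  push Not at hax
  set γ : ℝ → E4 := fun t ↦ y + t • E4.basisVector 1 with hγ
  have hγc : Continuous γ := by fun_prop
  have hγ0 : γ 0 = y := by simp [hγ]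
  have hopen : IsOpen (region a r₀ : Set E4) := (region a r₀).isOpen
  have hev : ∀ᶠ t in 𝓝 (0 : ℝ), γ t ∈ (region a r₀ : Set E4) := by
    have : (region a r₀ : Set E4) ∈ 𝓝 (γ 0) := by rw [hγ0]; exact hopen.mem_nhds hy
    exact hγc.continuousAt.preimage_mem_nhds this
  have hev' : ∀ᶠ t in 𝓝[≠] (0 : ℝ), G (γ t) = c := by
    filter_upwards [mem_nhdsWithin_of_mem_nhds hev, self_mem_nhdsWithin] with t ht ht0
    refine h _ ht (Or.inl ?_)
    simp [hγ, hax.1, E4.basisVector]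
    exact ht0
  have htend : Tendsto (fun t ↦ G (γ t)) (𝓝[≠] (0 : ℝ)) (𝓝 (G y)) := by
    have h1 : Tendsto γ (𝓝[≠] (0 : ℝ)) (𝓝[(region a r₀ : Set E4)] y) := by
      refine tendsto_nhdsWithin_iff.2 ⟨?_, mem_nhdsWithin_of_mem_nhds hev⟩
      rw [← hγ0]
      exact hγc.continuousAt.tendsto.mono_left nhdsWithin_le_nhds
    exact (hG y hy).tendsto.comp h1
  have hconst : Tendsto (fun t ↦ G (γ t)) (𝓝[≠] (0 : ℝ)) (𝓝 c) :=
    tendsto_const_nhds.congr' (hev'.mono fun t ht ↦ ht.symm)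
  exact tendsto_nhds_unique htend hconst

/-- The same density principle for a continuous function on the subtype `Kerr.region a r₀`.
[folklore] -/
theorem eq_of_offAxis_region {X : Type*} [TopologicalSpace X] [T2Space X] {a r₀ : ℝ}
    {G : region a r₀ → X} {c : X} (hG : Continuous G)
    (h : ∀ x : region a r₀, ((x : E4) 1 ≠ 0 ∨ (x : E4) 2 ≠ 0) → G x = c) (x : region a r₀) :
    G x = c := by
  classical
  set F : E4 → X := fun y ↦ if hy : y ∈ region a r₀ then G ⟨y, hy⟩ else c with hF
  have hFG : ∀ z : region a r₀, F z = G z := fun z ↦ by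
    show (if hy : (z : E4) ∈ region a r₀ then G ⟨z, hy⟩ else c) = G z
    rw [dif_pos z.2]
  have hcont : ContinuousOn F (region a r₀) := by
    rw [continuousOn_iff_continuous_restrict]
    have : (region a r₀ : Set E4).restrict F = G := funext fun z ↦ hFG z
    rw [this]
    exact hG
  have hoff : ∀ y ∈ region a r₀, (y 1 ≠ 0 ∨ y 2 ≠ 0) → F y = c := fun y hy hax ↦ by
    rw [show F y = G ⟨y, hy⟩ from hFG ⟨y, hy⟩]
    exact h ⟨y, hy⟩ hax
  rw [← hFG x]
  exact eqOn_region_of_offAxis hcont hoff x x.2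

/-! ### The chart as an immersion of the coordinate domain -/

namespace Ingoing

variable {M a r₀ : ℝ} {u : E4}

/-- The chart `Ψ` is `C^∞` on the coordinate domain as a map into the manifold `Kerr.region a r₀`.
[cite: arXiv07060622, §4] -/
theorem contMDiffOn_chart [Kerr.Facts] :
    ContMDiffOn 𝓘(ℝ, E4) 𝓘(ℝ, E4) ∞ (chart a r₀) (coordDomain r₀) := by
  intro u hu
  refine ContMDiffAt.contMDiffWithinAt ?_
  rw [← ContMDiffAt.subtypeVal_comp_iff]
  have h : (Subtype.val ∘ chart a r₀) = chartFun a r₀ := funext fun _ ↦ rfl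
  rw [h, contMDiffAt_iff_contDiffAt]
  exact contDiffAt_chartFun hu

/-- The manifold derivative of the chart at a point of the coordinate domain is its Jacobian `J`.
[cite: arXiv07060622, §4] -/
theorem mfderiv_chart (hu : u ∈ coordDomain r₀) :
    mfderiv 𝓘(ℝ, E4) 𝓘(ℝ, E4) (chart a r₀) u = jac a u := by
  have hd : MDifferentiableAt 𝓘(ℝ, E4) 𝓘(ℝ, E4) (chartFun a r₀) u :=
    mdifferentiableAt_iff_differentiableAt.2 (differentiableAt_chartFun hu)
  rw [OpensChart.mfderiv_codRestrict (f := chartFun a r₀) (fun _ ↦ rfl) hd, mfderiv_eq_fderiv,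
    fderiv_chartFun hu]

/-- The manifold derivative of the chart is injective on the coordinate domain. [folklore] -/
theorem injective_mfderiv_chart (u : E4) (hu : u ∈ (coordDomain r₀ : Set E4)) :
    Injective (mfderiv 𝓘(ℝ, E4) 𝓘(ℝ, E4) (chart a r₀) u) := by
  rw [mfderiv_chart hu]
  exact jac_injective hu

/-- The coordinate domain lies in the regular set `{Σ ≠ 0, μ² ≠ 1}`. [folklore] -/
theorem mem_regularSet_of_mem_coordDomain (hu : u ∈ coordDomain r₀) : u ∈ regularSet a :=
  ⟨sigma_ne_zero hu, sinSq_ne_zero hu⟩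

end Ingoing

/-! ### Ricci-flatness -/

section RicciFlat

variable [Kerr.Facts] (M a r₀ : ℝ) [(smoothMetric M a r₀).HasLeviCivita]

/-- **`Ric = 0` at the off-axis points**: at `x = Ψ u`, `u` in the coordinate domain, the Ricci
tensor of the Kerr metric vanishes — the pull-back metric `Ψ^* g` on the coordinate domain has the
rational Kerr components, hence vanishing Ricci tensor (`Kerr.Ingoing.ricci_eq_zero_of_repr`), and
`Ric^{Ψ^*g}_u(v, w) = Ric^g_{Ψ u}(dΨ v, dΨ w)` (O'Neill 1983, Ch. 3, Prop. 3.59) with `dΨ_u` onto.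
[cite: KerrSchild1965, §3] -/
theorem ricci_smoothMetric_chart {u : E4} (hu : u ∈ Ingoing.coordDomain r₀) :
    (smoothMetric M a r₀).ricci (Ingoing.chart a r₀ u) = 0 := by
  have hψ : ContMDiffOn 𝓘(ℝ, E4) 𝓘(ℝ, E4) ∞ (Ingoing.chart a r₀) (Ingoing.coordDomain r₀) :=
    Ingoing.contMDiffOn_chart
  have hψ' : ∀ z ∈ Ingoing.coordDomain r₀,
      Injective (mfderiv 𝓘(ℝ, E4) 𝓘(ℝ, E4) (Ingoing.chart a r₀) z) :=
    Ingoing.injective_mfderiv_chart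
  have hdim : Module.finrank ℝ E4 = Module.finrank ℝ E4 := rfl
  -- the pull-back metric on the coordinate domain
  let g' := (smoothMetric M a r₀).toPseudoRiemannianMetric.comap
    PseudoRiemannianMetric.contMDiff_pullbackBilin_holds
    (Ingoing.chart a r₀ ∘ (Subtype.val : Ingoing.coordDomain r₀ → E4))
    (contMDiff_immersedChart_comp_val hψ) (injective_mfderiv_immersedChart_comp_val hψ hψ') hdim
  haveI := g'.hasLeviCivita
  -- its components are the rational Kerr components
  have hrepr : ∀ z : Ingoing.coordDomain r₀, g'.val z = Ingoing.bilin M a z := fun z ↦ by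
    rw [val_comap_immersedChart (smoothMetric M a r₀).toPseudoRiemannianMetric hψ hψ' hdim z]
    ext v w
    rw [pullbackBilin_apply, Ingoing.mfderiv_chart z.2]
    exact Ingoing.kerrBilin_jac z.2 v w
  have hzero : g'.ricci ⟨u, hu⟩ = 0 :=
    Ingoing.ricci_eq_zero_of_repr M a g' hrepr ⟨u, hu⟩ (Ingoing.mem_regularSet_of_mem_coordDomain hu)
  -- naturality of the Ricci tensor under the local isometry `Ψ`
  have hnat : ∀ v w : E4, (smoothMetric M a r₀).ricci (Ingoing.chart a r₀ u) (Ingoing.jac a u v)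
      (Ingoing.jac a u w) = 0 := by
    intro v w
    have h2 := (smoothMetric M a r₀).toPseudoRiemannianMetric.ricci_comap_apply
      PseudoRiemannianMetric.contMDiff_pullbackBilin_holds (contMDiff_immersedChart_comp_val hψ)
      (injective_mfderiv_immersedChart_comp_val hψ hψ') hdim ⟨u, hu⟩ v w
    have h0 : g'.ricci ⟨u, hu⟩ v w = 0 := by rw [hzero]; rfl
    rw [h0, mfderiv_immersedChart_comp_val_apply hψ ⟨u, hu⟩ v,
      mfderiv_immersedChart_comp_val_apply hψ ⟨u, hu⟩ w, Ingoing.mfderiv_chart hu] at h2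
    exact h2.symm
  -- `dΨ_u` is onto
  have hsurj : Surjective (Ingoing.jac a u) := by
    have hinj := Ingoing.jac_injective (a := a) hu
    exact LinearMap.surjective_of_injective (f := (Ingoing.jac a u).toLinearMap) hinj
  ext V W
  obtain ⟨v, rfl⟩ := hsurj V
  obtain ⟨w, rfl⟩ := hsurj W
  rw [hnat v w]
  rfl

/-- **The Kerr metric is Ricci-flat**, smooth-regularity form: `Ric(g_{M,a}) = 0` at every point of
`Kerr.region a r₀` for the `C^∞` metric `Kerr.smoothMetric M a r₀` (the metric of
`Kerr.spacetime M a r₀ hM` by `rfl`), for all real `M, a, r₀` — these spacetimes are vacuum.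
Kerr, PRL 11 (1963); Kerr–Schild 1965, §3; O'Neill 1995, Ch. 2, Thm. 2.6.1.
[cite: KerrSchild1965, §3] -/
theorem ricci_smoothMetric (x : region a r₀) : (smoothMetric M a r₀).ricci x = 0 := by
  set g := (smoothMetric M a r₀).toPseudoRiemannianMetric with hg
  -- every component `x ↦ Ric_x(V, W)` is continuous and vanishes off the axis
  suffices h : ∀ V W : E4, g.ricci x V W = 0 by
    ext V W; exact h V W
  intro V W
  have hcont : Continuous fun y : region a r₀ ↦ g.ricci y V W := by
    have hV : ContMDiff 𝓘(ℝ, E4) (𝓘(ℝ, E4).prod 𝓘(ℝ, E4)) ∞ (fun y : region a r₀ ↦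
        (TotalSpace.mk' E4 y (V : TangentSpace 𝓘(ℝ, E4) y) : TangentBundle 𝓘(ℝ, E4) (region a r₀))) :=
      fun y ↦ OpensChart.contMDiffAt_const_section y V
    have hW : ContMDiff 𝓘(ℝ, E4) (𝓘(ℝ, E4).prod 𝓘(ℝ, E4)) ∞ (fun y : region a r₀ ↦
        (TotalSpace.mk' E4 y (W : TangentSpace 𝓘(ℝ, E4) y) : TangentBundle 𝓘(ℝ, E4) (region a r₀))) :=
      fun y ↦ OpensChart.contMDiffAt_const_section y W
    exact (g.contMDiff_ricci_apply' hV hW).continuous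
  refine eq_of_offAxis_region hcont (fun y hy ↦ ?_) x
  obtain ⟨u, hu, hux⟩ := Ingoing.exists_chartFun_eq (a := a) y.2 hy
  have hy' : Ingoing.chart a r₀ u = y := Subtype.ext hux
  have h := ricci_smoothMetric_chart M a r₀ hu
  rw [hy'] at h
  rw [show g.ricci y V W = (smoothMetric M a r₀).ricci y V W from rfl, h]
  rfl

/-- The Kerr metric is Ricci-flat in the sense of `PseudoRiemannianMetric.IsRicciFlat`
(`Einstein.lean`; the form consumed by `DataEmbedding.IsVacuum` / `VacuumCauchyDevelopment`):
the `C^∞` Kerr–Schild metric `Kerr.smoothMetric M a r₀` on `Kerr.region a r₀` satisfies the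
Einstein vacuum equations, for all real `M, a, r₀`. Kerr–Schild 1965, §3; O'Neill 1983, Ch. 12,
pp. 336–337. [cite: KerrSchild1965, §3] -/
theorem isRicciFlat_smoothMetric : (smoothMetric M a r₀).toPseudoRiemannianMetric.IsRicciFlat :=
  fun x ↦ ricci_smoothMetric M a r₀ x

end RicciFlat

/-- **The Kerr metric is Ricci-flat — DISCHARGE of the named fact `Kerr.isRicciFlat`**: for all real
`M`, `a`, `r₀`, the Kerr–Schild metric `g_{M,a} = η + 2H ℓ ⊗ ℓ` on the chart domain
`Kerr.region a r₀ = {r > max r₀ 0}` (ingoing Kerr–Schild Cartesian coordinates; the metric of the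
spacetimes `Kerr.spacetime M a r₀ hM`, `Kerr.exteriorSpacetime M a hM` for `M ≥ 0`) satisfies
`Ric = 0`. Kerr, PRL 11 (1963); Kerr–Schild 1965, §3; O'Neill 1995, Ch. 2, Thm. 2.6.1. The
curvature is that of the Levi-Civita connection of the prelude (`LeviCivita.lean`) under its
standing hypothesis, at the analytic regularity of `Kerr.metric` (definitionally the same connection
as for `Kerr.smoothMetric`). [cite: KerrSchild1965, §3] -/
theorem isRicciFlat_holds [Kerr.Facts] (M a r₀ : ℝ) : Kerr.isRicciFlat M a r₀ := by
  intro h y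
  haveI : (Kerr.smoothMetric M a r₀).HasLeviCivita := h
  exact ricci_smoothMetric M a r₀ y

end Kerr

end Literature.Geometry.Lorentzian

end
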